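import Summits.ValiantsHypothesis.ValiantsHypothesis.Theorems.BarrierLeverPartitionMinorsPairSplit

/-!
# Route BarrierLever — Chow witnesses for partition minors (items 20172 / 20195): the literal-pair
# split, MIXED parity, and permutation invariance

Helper file (`--supports stmt-ValiantsHypothesis-20195`; cell valiant-natproofs, rung V4, 𝒟-side of
door (c); seat val-np-p4 gen 10).  Closes NO item.  Companion of `…PartitionMinorsPairSplit`
(`chow_pairSplit`, equal parity: rows containing `a` against columns containing `c`).

* `chow_pairSplit_mixed` — the MIXED parity: the first `k` rows AVOID `a` while the first `k` columns
  CONTAIN `c` (and the last `m` rows contain `a`, the last `m` columns avoid `c`).  Gadget: the single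
  affine form `x_a + y_c` (multilinear coefficients `0, 1, 1, 0`, `coeff_mixedGadget`) and a constant
  form `1`; the partition matrix is again block-diagonal in this indexing.
* `chow_hit_of_perm` — hitting is invariant under re-indexing rows and columns of the layout
  (`Matrix.det_permute`, `Matrix.det_permute'`), so any pair of literal classes of equal size can be
  brought into block form.

With `…PairSplit`, `…CoordinateLift` and `…GenericChowProduct` this completes the reduction step of a
locked-core engine for Chow witnesses (the engine itself — induction on the height over UNLOCKED
layouts, as in `FiniteCheck.tt_height_le_of_lockedCore` for transversal layouts — is not written here).

WHAT THIS IS NOT: a reduction step; nothing on items 20195 / 20172 / 19717 themselves, on crux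
stmt-ValiantsHypothesis-14610, or on `VP` versus `VNP`.
-/

set_option linter.dupNamespace false

namespace Summit.ValiantsHypothesis.ValiantsHypothesis.Theorems.BarrierLever.ChowFactor

open Finset MvPolynomial
open Summit.ValiantsHypothesis.ValiantsHypothesis.Theorems.BarrierLever.ProductStateSums
  (castAdd_ne_natAdd partitionExpo_apply_castAdd partitionExpo_apply_natAdd)
open Summit.ValiantsHypothesis.ValiantsHypothesis.Theorems.BarrierLever.CorankRepair (partitionExpo_eq_iff)

noncomputable section

variable {h : ℕ}

/-! ## 1. Permutation invariance -/

/-- **Hitting is invariant under re-indexing the layout.** -/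
theorem chow_hit_of_perm {n : ℕ} {r : ℕ} (u w : Fin r → Finset (Fin n)) (σ τ : Equiv.Perm (Fin r))
    (hhit : ∃ ℓ : Fin (n + n) → MvPolynomial (Fin (n + n)) ℂ, (∀ q, (ℓ q).totalDegree ≤ 1) ∧
      (Matrix.of fun i j : Fin r => coeff
        (∑ b ∈ u (σ i), Finsupp.single (Fin.castAdd n b) 1 + ∑ d ∈ w (τ j), Finsupp.single (Fin.natAdd n d) 1)
        (∏ q, ℓ q)).det ≠ 0) :
    ∃ ℓ : Fin (n + n) → MvPolynomial (Fin (n + n)) ℂ, (∀ q, (ℓ q).totalDegree ≤ 1) ∧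
      (Matrix.of fun i j : Fin r => coeff
        (∑ b ∈ u i, Finsupp.single (Fin.castAdd n b) 1 + ∑ d ∈ w j, Finsupp.single (Fin.natAdd n d) 1)
        (∏ q, ℓ q)).det ≠ 0 := by
  obtain ⟨ℓ, hdeg, hdet⟩ := hhit
  refine ⟨ℓ, hdeg, ?_⟩
  intro hzero
  apply hdet
  have hM : (Matrix.of fun i j : Fin r => coeff
      (∑ b ∈ u (σ i), Finsupp.single (Fin.castAdd n b) 1 + ∑ d ∈ w (τ j), Finsupp.single (Fin.natAdd n d) 1)
      (∏ q, ℓ q)) =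
      ((Matrix.of fun i j : Fin r => coeff
        (∑ b ∈ u i, Finsupp.single (Fin.castAdd n b) 1 + ∑ d ∈ w j, Finsupp.single (Fin.natAdd n d) 1)
        (∏ q, ℓ q)).submatrix σ id).submatrix id τ := by
    ext i j
    rfl
  rw [hM, Matrix.det_permute', Matrix.det_permute, hzero, mul_zero, mul_zero]

/-! ## 2. The mixed gadget `x_a + y_c` -/

/-- The mixed gadget as a full affine combination. -/
theorem mixedGadget_eq (a c : Fin (h + 1)) :
    (C 0 + ∑ a' : Fin (h + 1), C (if a' = a then (1 : ℂ) else 0) * X (Fin.castAdd (h + 1) a') +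
        ∑ c' : Fin (h + 1), C (if c' = c then (1 : ℂ) else 0) * X (Fin.natAdd (h + 1) c') :
      MvPolynomial (Fin ((h + 1) + (h + 1))) ℂ) =
      C 0 + C 1 * X (Fin.castAdd (h + 1) a) + C 1 * X (Fin.natAdd (h + 1) c) := by
  rw [Finset.sum_eq_single a, Finset.sum_eq_single c, if_pos rfl, if_pos rfl]
  · intro c' _ hc'
    rw [if_neg hc', C_0, zero_mul]
  · intro hc
    exact absurd (Finset.mem_univ c) hc
  · intro a' _ ha'
    rw [if_neg ha', C_0, zero_mul]
  · intro ha
    exact absurd (Finset.mem_univ a) ha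

/-- The mixed gadget has total degree `≤ 1`. -/
theorem totalDegree_mixedGadget_le (a c : Fin (h + 1)) :
    (C 0 + C 1 * X (Fin.castAdd (h + 1) a) + C 1 * X (Fin.natAdd (h + 1) c) :
      MvPolynomial (Fin ((h + 1) + (h + 1))) ℂ).totalDegree ≤ 1 := by
  refine (totalDegree_add _ _).trans (max_le ((totalDegree_add _ _).trans (max_le ?_ ?_)) ?_)
  · rw [totalDegree_C]
    exact Nat.zero_le _
  · refine (totalDegree_mul _ _).trans ?_
    rw [totalDegree_C, totalDegree_X, zero_add]
  · refine (totalDegree_mul _ _).trans ?_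
    rw [totalDegree_C, totalDegree_X, zero_add]

/-- The mixed gadget involves only `x_a` and `y_c`. -/
theorem support_mixedGadget (a c : Fin (h + 1)) :
    ∀ m ∈ (C 0 + C 1 * X (Fin.castAdd (h + 1) a) + C 1 * X (Fin.natAdd (h + 1) c) :
        MvPolynomial (Fin ((h + 1) + (h + 1))) ℂ).support,
      ∀ v, ¬ (v = Fin.castAdd (h + 1) a ∨ v = Fin.natAdd (h + 1) c) → m v = 0 := by
  classical
  intro m hm v hv
  by_contra hne
  have hvars : v ∈ (C 0 + C 1 * X (Fin.castAdd (h + 1) a) + C 1 * X (Fin.natAdd (h + 1) c) :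
      MvPolynomial (Fin ((h + 1) + (h + 1))) ℂ).vars :=
    (mem_vars_iff_mem_support v).mpr ⟨m, hm, Finsupp.mem_support_iff.mpr hne⟩
  have hsub : (C 0 + C 1 * X (Fin.castAdd (h + 1) a) + C 1 * X (Fin.natAdd (h + 1) c) :
      MvPolynomial (Fin ((h + 1) + (h + 1))) ℂ).vars ⊆ {Fin.castAdd (h + 1) a, Fin.natAdd (h + 1) c} := by
    refine (vars_add_subset _ _).trans (Finset.union_subset ((vars_add_subset _ _).trans
      (Finset.union_subset ?_ ?_)) ?_)
    · rw [vars_C]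
      exact Finset.empty_subset _
    · refine (vars_mul _ _).trans (Finset.union_subset ?_ ?_)
      · rw [vars_C]
        exact Finset.empty_subset _
      · rw [vars_X]
        exact Finset.singleton_subset_iff.mpr (by simp)
    · refine (vars_mul _ _).trans (Finset.union_subset ?_ ?_)
      · rw [vars_C]
        exact Finset.empty_subset _
      · rw [vars_X]
        exact Finset.singleton_subset_iff.mpr (by simp)
  have hv' := hsub hvars
  simp only [Finset.mem_insert, Finset.mem_singleton] at hv'
  exact hv hv'

/-- **The four multilinear coefficients of the mixed gadget**: `0, 1, 1, 0`. -/
theorem coeff_mixedGadget (a c : Fin (h + 1)) (U W : Finset (Fin (h + 1)))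
    (hU : U = ∅ ∨ U = {a}) (hW : W = ∅ ∨ W = {c}) :
    coeff (∑ a' ∈ U, Finsupp.single (Fin.castAdd (h + 1) a') 1 +
        ∑ c' ∈ W, Finsupp.single (Fin.natAdd (h + 1) c') 1)
      (C 0 + C 1 * X (Fin.castAdd (h + 1) a) + C 1 * X (Fin.natAdd (h + 1) c) :
        MvPolynomial (Fin ((h + 1) + (h + 1))) ℂ) =
      if (U = ∅ ∧ W = {c}) ∨ (U = {a} ∧ W = ∅) then 1 else 0 := by
  classical
  rw [← mixedGadget_eq a c, coeff_partitionExpo_affine]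
  have hane : ({a} : Finset (Fin (h + 1))) ≠ ∅ := Finset.singleton_ne_empty a
  have hcne : ({c} : Finset (Fin (h + 1))) ≠ ∅ := Finset.singleton_ne_empty c
  rcases hU with rfl | rfl <;> rcases hW with rfl | rfl
  all_goals simp [hane, hcne, hane.symm, hcne.symm]

/-! ## 3. The mixed-parity split -/

/-- **LITERAL-PAIR SPLIT for Chow witnesses (block form, MIXED parity).**  Rows `castAdd m i` avoid
`a`, rows `natAdd k i` contain `a`; columns `castAdd m j` CONTAIN `c`, columns `natAdd k j` avoid it.
If the two projected layouts of height `h` are hit, so is `(u, w)` at height `h + 1`. -/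
theorem chow_pairSplit_mixed (a c : Fin (h + 1)) {k m : ℕ} (u w : Fin (k + m) → Finset (Fin (h + 1)))
    (hu0 : ∀ i : Fin k, a ∉ u (Fin.castAdd m i)) (hu1 : ∀ i : Fin m, a ∈ u (Fin.natAdd k i))
    (hw0 : ∀ j : Fin k, c ∈ w (Fin.castAdd m j)) (hw1 : ∀ j : Fin m, c ∉ w (Fin.natAdd k j))
    (h0 : ∃ ℓ : Fin (h + h) → MvPolynomial (Fin (h + h)) ℂ, (∀ q, (ℓ q).totalDegree ≤ 1) ∧
      (Matrix.of fun i j : Fin k => coeff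
        (∑ b ∈ (u (Fin.castAdd m i)).preimage a.succAbove Fin.succAbove_right_injective.injOn,
            Finsupp.single (Fin.castAdd h b) 1 +
          ∑ d ∈ (w (Fin.castAdd m j)).preimage c.succAbove Fin.succAbove_right_injective.injOn,
            Finsupp.single (Fin.natAdd h d) 1)
        (∏ q, ℓ q)).det ≠ 0)
    (h1 : ∃ ℓ : Fin (h + h) → MvPolynomial (Fin (h + h)) ℂ, (∀ q, (ℓ q).totalDegree ≤ 1) ∧
      (Matrix.of fun i j : Fin m => coeff
        (∑ b ∈ (u (Fin.natAdd k i)).preimage a.succAbove Fin.succAbove_right_injective.injOn,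
            Finsupp.single (Fin.castAdd h b) 1 +
          ∑ d ∈ (w (Fin.natAdd k j)).preimage c.succAbove Fin.succAbove_right_injective.injOn,
            Finsupp.single (Fin.natAdd h d) 1)
        (∏ q, ℓ q)).det ≠ 0) :
    ∃ ℓ : Fin ((h + 1) + (h + 1)) → MvPolynomial (Fin ((h + 1) + (h + 1))) ℂ,
      (∀ q, (ℓ q).totalDegree ≤ 1) ∧
      (Matrix.of fun i j : Fin (k + m) => coeff
        (∑ a' ∈ u i, Finsupp.single (Fin.castAdd (h + 1) a') 1 +
          ∑ c' ∈ w j, Finsupp.single (Fin.natAdd (h + 1) c') 1)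
        (∏ q, ℓ q)).det ≠ 0 := by
  classical
  obtain ⟨ℓ, hdeg, hA, hD⟩ := exists_common_chow_witness₂ _ _ _ _ h0 h1
  -- the lift and the two gadget forms
  set L : Fin (h + h) → Fin ((h + 1) + (h + 1)) := Fin.append
    (fun b : Fin h => Fin.castAdd (h + 1) (a.succAbove b))
    (fun d : Fin h => Fin.natAdd (h + 1) (c.succAbove d)) with hL
  set f₁ : MvPolynomial (Fin ((h + 1) + (h + 1))) ℂ :=
    C 0 + C 1 * X (Fin.castAdd (h + 1) a) + C 1 * X (Fin.natAdd (h + 1) c) with hf₁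
  set f₂ : MvPolynomial (Fin ((h + 1) + (h + 1))) ℂ := 1 with hf₂
  have hcard : (h + h) + 2 = (h + 1) + (h + 1) := by omega
  set e : Fin ((h + h) + 2) ≃ Fin ((h + 1) + (h + 1)) := finCongr hcard with he
  set ℓ' : Fin ((h + h) + 2) → MvPolynomial (Fin ((h + 1) + (h + 1))) ℂ :=
    Fin.append (fun q => rename L (ℓ q)) ![f₁, f₂] with hℓ'
  refine ⟨fun q => ℓ' (e.symm q), fun q => ?_, ?_⟩
  · show (ℓ' (e.symm q)).totalDegree ≤ 1
    generalize e.symm q = q₀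
    rw [hℓ']
    induction q₀ using Fin.addCases with
    | left q' =>
      rw [Fin.append_left]
      exact totalDegree_rename_le_one L (ℓ q') (hdeg q')
    | right q' =>
      rw [Fin.append_right]
      fin_cases q'
      · exact totalDegree_mixedGadget_le a c
      · simp [hf₂]
  · -- the product
    have hprod : (∏ q, ℓ' (e.symm q)) = (f₁ * f₂) * rename L (∏ q, ℓ q) := by
      rw [Fintype.prod_equiv e.symm (fun q => ℓ' (e.symm q)) ℓ' (fun _ => rfl), hℓ',
        Fin.prod_univ_add]
      simp only [Fin.append_left, Fin.append_right, Fin.prod_univ_two, Matrix.cons_val_zero,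
        Matrix.cons_val_one]
      rw [map_prod, mul_comm]
    rw [hprod]
    -- entries of the partition matrix
    have hentry : ∀ i j : Fin (k + m), coeff
        (∑ a' ∈ u i, Finsupp.single (Fin.castAdd (h + 1) a') 1 +
          ∑ c' ∈ w j, Finsupp.single (Fin.natAdd (h + 1) c') 1) ((f₁ * f₂) * rename L (∏ q, ℓ q)) =
        (if (u i ∩ {a} = ∅ ∧ w j ∩ {c} = {c}) ∨ (u i ∩ {a} = {a} ∧ w j ∩ {c} = ∅) then (1 : ℂ)
          else 0) *
        coeff (∑ b ∈ (u i).preimage a.succAbove Fin.succAbove_right_injective.injOn,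
            Finsupp.single (Fin.castAdd h b) 1 +
          ∑ d ∈ (w j).preimage c.succAbove Fin.succAbove_right_injective.injOn,
            Finsupp.single (Fin.natAdd h d) 1) (∏ q, ℓ q) := by
      intro i j
      rw [hf₂, mul_one, coeff_partitionExpo_mul_pairFactor _ _ a c (support_mixedGadget a c)
        (support_rename_lift a c _) (u i) (w j)]
      have hfa : (u i).filter (fun a' => a' = a) = u i ∩ {a} := by
        ext x; simp [Finset.mem_filter, Finset.mem_inter]
      have hfc : (w j).filter (fun c' => c' = c) = w j ∩ {c} := by
        ext x; simp [Finset.mem_filter, Finset.mem_inter]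
      rw [hfa, hfc, coeff_mixedGadget a c _ _ ?_ ?_, erase_eq_map_preimage_succAbove,
        erase_eq_map_preimage_succAbove, coeff_lift_rename]
      · by_cases ha : a ∈ u i
        · right; rw [Finset.inter_singleton_of_mem ha]
        · left; rw [Finset.inter_singleton_of_notMem ha]
      · by_cases hc : c ∈ w j
        · right; rw [Finset.inter_singleton_of_mem hc]
        · left; rw [Finset.inter_singleton_of_notMem hc]
    -- block form
    have hane : ({a} : Finset (Fin (h + 1))) ≠ ∅ := Finset.singleton_ne_empty a
    have hcne : ({c} : Finset (Fin (h + 1))) ≠ ∅ := Finset.singleton_ne_empty c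
    set A : Matrix (Fin k) (Fin k) ℂ := Matrix.of fun i j : Fin k => coeff
        (∑ b ∈ (u (Fin.castAdd m i)).preimage a.succAbove Fin.succAbove_right_injective.injOn,
            Finsupp.single (Fin.castAdd h b) 1 +
          ∑ d ∈ (w (Fin.castAdd m j)).preimage c.succAbove Fin.succAbove_right_injective.injOn,
            Finsupp.single (Fin.natAdd h d) 1) (∏ q, ℓ q) with hAdef
    set D : Matrix (Fin m) (Fin m) ℂ := Matrix.of fun i j : Fin m => coeff
        (∑ b ∈ (u (Fin.natAdd k i)).preimage a.succAbove Fin.succAbove_right_injective.injOn,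
            Finsupp.single (Fin.castAdd h b) 1 +
          ∑ d ∈ (w (Fin.natAdd k j)).preimage c.succAbove Fin.succAbove_right_injective.injOn,
            Finsupp.single (Fin.natAdd h d) 1) (∏ q, ℓ q) with hDdef
    have hN : (Matrix.of fun i j : Fin (k + m) => coeff
        (∑ a' ∈ u i, Finsupp.single (Fin.castAdd (h + 1) a') 1 +
          ∑ c' ∈ w j, Finsupp.single (Fin.natAdd (h + 1) c') 1) ((f₁ * f₂) * rename L (∏ q, ℓ q))) =
        Matrix.reindex finSumFinEquiv finSumFinEquiv (Matrix.fromBlocks A 0 0 D) := by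
      ext i j
      rw [Matrix.of_apply, hentry, Matrix.reindex_apply, Matrix.submatrix_apply]
      induction i using Fin.addCases with
      | left i₀ =>
        induction j using Fin.addCases with
        | left j₀ =>
          rw [finSumFinEquiv_symm_apply_castAdd, finSumFinEquiv_symm_apply_castAdd,
            Matrix.fromBlocks_apply₁₁, hAdef, Matrix.of_apply,
            Finset.inter_singleton_of_notMem (hu0 i₀), Finset.inter_singleton_of_mem (hw0 j₀)]
          simp
        | right j₁ =>
          rw [finSumFinEquiv_symm_apply_castAdd, finSumFinEquiv_symm_apply_natAdd,
            Matrix.fromBlocks_apply₁₂, Matrix.zero_apply,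
            Finset.inter_singleton_of_notMem (hu0 i₀), Finset.inter_singleton_of_notMem (hw1 j₁)]
          simp [hcne.symm]
      | right i₁ =>
        induction j using Fin.addCases with
        | left j₀ =>
          rw [finSumFinEquiv_symm_apply_natAdd, finSumFinEquiv_symm_apply_castAdd,
            Matrix.fromBlocks_apply₂₁, Matrix.zero_apply,
            Finset.inter_singleton_of_mem (hu1 i₁), Finset.inter_singleton_of_mem (hw0 j₀)]
          simp [hane, hcne]
        | right j₁ =>
          rw [finSumFinEquiv_symm_apply_natAdd, finSumFinEquiv_symm_apply_natAdd,
            Matrix.fromBlocks_apply₂₂, hDdef, Matrix.of_apply,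
            Finset.inter_singleton_of_mem (hu1 i₁), Finset.inter_singleton_of_notMem (hw1 j₁)]
          simp [hane]
    rw [hN, Matrix.det_reindex_self, Matrix.det_fromBlocks_zero₁₂]
    exact mul_ne_zero hA hD

end

end Summit.ValiantsHypothesis.ValiantsHypothesis.Theorems.BarrierLever.ChowFactor
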